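import Mathlib
import Literature.Computability.Complexity.NisanRandomizedLowerBound
import Literature.Computability.MetaComplexity.ChenJinSanthanamWilliams2022.QueryRefuterMagnification
import HarnessLib

/-!
# The coin problem `GapMAJ_{n,ε}` against RANDOMIZED query algorithms: `R_{1/3}(GapMAJ_{n,1/e}) =
# Ω(1/ε)` by Nisan's block-sensitivity bound `bs ≤ 3·R₂` (census row R37, K side, randomized
# model — the `Ω(1/ε)` part of the printed `Θ(1/ε²)`)

Topic `Literature/Computability/MetaComplexity`, directory `ChenJinSanthanamWilliams2022/`
(bib key `ChenEtAl2022`).  `QueryRefuterMagnification.lean` types Chen–Jin–Santhanam–Williams'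
Thm. 1.6 (census row R37): uniform refuters for `GapMAJ_{n,ε}`, `ε = 1/e(n)`, against bounded-gap
RANDOMIZED query algorithms (`RandQueryAlg = (n : ℕ) → PMF (DecisionTree n)`) using `o(1/ε²)`
queries magnify to `P ≠ NP` / `P ≠ PSPACE`; its printed KNOWN side (p. 6 L1: *"It is well-known
that every randomized query algorithm needs `Θ(1/ε²)` queries to solve `GapMAJ_{n,ε}` with constant
success probability"*, citing [BrodyV10]; the sampling bound is Canetti–Even–Goldreich 1995) is not
typed there, and `GapMajDeterministicQuery.lean` proved the known column only for the DETERMINISTIC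
sub-model.  This file proves, in the row's own randomized
vocabulary (`PMF (DecisionTree n)`, `toOuterMeasure`, `RandQueryAlg.QueriesLe`,
`RandQueryAlg.FailsOn`, the tree's `randQueryComplexityOn`), the weaker-than-printed but genuinely
randomized lower bound `Ω(1/ε)`, by running the tree's formalisation of Nisan's theorem
`bs(f) ≤ 3·R₂(f)` (`Complexity/NisanRandomizedLowerBound.lean`: `PMF.ofReal_le_toOuterMeasure_flip_ne`,
`PMF.sum_toOuterMeasure_flip_ne_le`) on the PROMISE problem:

* BLOCKS OF THE PROMISE PROBLEM VERSUS RANDOMIZED DEPTH (`card_blocks_le_three_mul`): if a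
  distribution `μ` over trees of depth `≤ q` answers correctly with probability `≥ 2/3` on every
  promise input of `GapMAJ_{n,1/e}`, and the YES instance `x` carries `k` pairwise disjoint blocks
  `B` with every `x^B` a NO instance, then `k ≤ 3q` (on `x` versus `x^B` the answer must change
  with probability `≥ 1/3`, so a variable of `B` is read with probability `≥ 1/3`; the expected
  number of queries on `x` is `≤ q`).
* THE BOUND (`le_three_mul_randDepth`, `le_three_mul_randQueryComplexityOn_gapMaj`): a YES
  instance with the minimal number `A` of ones, cut into blocks of `A − W` ones (`W` the maximal NO
  weight; `exists_disjoint_blocks`, `flipBlock_indicator`), gives `k ≤ 3q` for every `k` with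
  `k·(A − W) ≤ A`; with `A = ⌊n/2⌋ + ⌊n/e⌋ + 2`, `W = ⌊n/2⌋ − ⌊n/e⌋ − 2` (`yes_weight`, `no_weight`)
  this is `3·R_{1/3}(GapMAJ_{n,1/e}) ≥ ⌊A/(2⌊n/e⌋ + 4)⌋ = Ω(min(e, n))`, i.e. `Ω(1/ε)` for
  `ε ≥ 1/n`.
* ROW VOCABULARY (`exists_failsOn_of_queriesLe`, `eventually_exists_failsOn_of_isLittleO`): every
  `A : RandQueryAlg` all of whose trees at length `n` have depth `≤ q(n)` FAILS (is correct with
  probability `< 2/3`) on SOME promise input at every length with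
  `(3q(n) + 1)·(2⌊n/e(n)⌋ + 4) ≤ ⌊n/2⌋`, `3 ≤ e(n)`, `12 ≤ n`; hence at all large lengths when
  `q = o(e)`, `e → ∞` and `e(n) ≤ n`.  The sub-class of the row's refuted class
  `SubquadraticQueryAlgs e` so covered is the `o(1/ε)`-query algorithms
  (`mem_subquadraticQueryAlgs_of_isLittleO`); the printed bound covers `o(1/ε²)` queries and needs
  the anti-concentration argument of [CEG95], which is NOT formalised here.  The failing input is
  one of `≤ 3q(n) + 2` explicit candidates (`x` or some `x^B`) but which one depends on the
  algorithm; nothing is claimed about the row's residual (UNIFORM printability).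

All statements are fully proved (no definition, no named fact); none is printed verbatim in
[ChenEtAl2022].  Sources of the METHOD: [Buhrman–de Wolf 2002, Thm. 16 p. 36 L15–22 (Nisan 1991:
`bs(f) ≤ 3R₂(f)`: *"for every set S such that f(x) ≠ f(x^S), the probability that the algorithm
queries a variable in S must be ≥ 1/3 … the total expected number of queries on input x must be at
least bs(f)/3"*), §2.2 (randomized decision trees as distributions over deterministic trees)], in
the tree as `Complexity/NisanRandomizedLowerBound.lean` (total functions; reused here pointwise);
[Jukna 2012 (BFC), §14.3 pp. 409–410 (block sensitivity `bs(f,a)`: disjoint blocks `S_i` with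
`f(a^{S_i}) ≠ f(a)`)].  Source of the ROW: [ChenEtAl2022, §1.2.2 p. 5 L31–33, p. 6 L1, Thm. 1.6].

References: [cite: ChenEtAl2022, §1.2.2 (GapMAJ_{n,ε}, p. 5 L31–33; p. 6 L1 known column), Thm. 1.6];
[cite: Wolf2002, Thm. 16 (Nisan, bs(f) ≤ 3R₂(f); TCS 288 (2002) p. 36 L15–22) and §2.2];
[cite: Nisan1991, Thm. (bounded-error randomized decision trees need Ω(bs(f)) queries)];
[cite: JuknaBFC2012, §14.3 (block sensitivity, pp. 409–410)].
-/

open Finset Filter Asymptotics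
open scoped ENNReal

namespace Literature.Computability.MetaComplexity.ChenJinSanthanamWilliams2022

open Literature.Computability.Complexity Literature.Computability.Complexity.DecisionTree

variable {n : ℕ}

/-! ### Nisan's bound for the promise problem -/

/-- **Nisan's bound for the promise problem: number of disjoint YES→NO blocks ≤ 3 × depth.**  Let
`μ` be a distribution over trees of depth `≤ q` that is correct with probability `≥ 2/3` on every
promise input of `GapMAJ_{n,1/e}`; let `x` be a YES instance and `𝓑` a family of pairwise disjoint
blocks such that each `x^B` (`flipBlock x B`) is a NO instance.  Then `|𝓑| ≤ 3q` — the tree's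
Nisan lemmas (`PMF.ofReal_le_toOuterMeasure_flip_ne`, `PMF.sum_toOuterMeasure_flip_ne_le`, stated
there for total functions at a point) run on the total function `gapMajAnswer e`, whose correctness
is only used at the promise inputs `x`, `x^B`.
[cite: Wolf2002, Thm. 16 (Nisan, bs(f) ≤ 3R₂(f), p. 36 L15–22); JuknaBFC2012, §14.3 (bs(f,a), pp. 409–410)] -/
theorem card_blocks_le_three_mul (μ : PMF (DecisionTree n)) {q e : ℕ}
    (hq : ∀ T ∈ μ.support, T.depth ≤ q)
    (hcorrect : ∀ y ∈ gapMajDomain n e,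
      (2 : ℝ) / 3 ≤ (μ.toOuterMeasure {T | T.eval y = gapMajAnswer e y}).toReal)
    (x : Fin n → Bool) (hx : GapMajYes e x) (𝓑 : Finset (Finset (Fin n)))
    (hdisj : (𝓑 : Set (Finset (Fin n))).PairwiseDisjoint id)
    (hno : ∀ B ∈ 𝓑, GapMajNo e (flipBlock x B)) : 𝓑.card ≤ 3 * q := by
  classical
  have hcorr' : ∀ y ∈ gapMajDomain n e,
      1 - (1 : ℝ) / 3 ≤ (μ.toOuterMeasure {T | T.eval y = gapMajAnswer e y}).toReal := by
    intro y hy; have := hcorrect y hy; norm_num at this ⊢; exact this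
  -- per block: `x^B` is answered differently from `x` with probability `≥ 1 - 2/3`
  have hlow : ∑ B ∈ 𝓑, ENNReal.ofReal (1 - 2 * (1 / 3)) ≤
      ∑ B ∈ 𝓑, μ.toOuterMeasure {T | T.eval (flipBlock x B) ≠ T.eval x} := by
    refine sum_le_sum fun B hB => ?_
    refine PMF.ofReal_le_toOuterMeasure_flip_ne μ (f := gapMajAnswer e) (hcorr' x (Or.inl hx))
      (hcorr' (flipBlock x B) (Or.inr (hno B hB))) ?_
    show gapMajAnswer e (flipBlock x B) ≠ gapMajAnswer e x
    rw [gapMajAnswer, gapMajAnswer, decide_eq_false (not_gapMajYes_of_gapMajNo (hno B hB)),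
      decide_eq_true hx]
    exact Bool.false_ne_true
  -- summed over the disjoint family: expected number of blocks read `≤ q`
  have hup := PMF.sum_toOuterMeasure_flip_ne_le μ hq x 𝓑 hdisj
  rw [sum_const, nsmul_eq_mul] at hlow
  have h : (𝓑.card : ℝ≥0∞) * ENNReal.ofReal (1 - 2 * (1 / 3)) ≤ (q : ℝ≥0∞) := hlow.trans hup
  have h' := ENNReal.toReal_mono (ENNReal.natCast_ne_top _) h
  rw [ENNReal.toReal_mul, ENNReal.toReal_natCast, ENNReal.toReal_natCast,
    ENNReal.toReal_ofReal (by norm_num)] at h'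
  have : (𝓑.card : ℝ) ≤ 3 * q := by linarith
  exact_mod_cast this

/-! ### Disjoint blocks inside a set -/

/-- `k` pairwise disjoint `D`-subsets of a set with at least `k·D` elements (`D ≥ 1`).
[cite: JuknaBFC2012, §14.3 (disjoint sensitive blocks)] -/
theorem exists_disjoint_blocks {α : Type*} [DecidableEq α] (Y : Finset α) {D : ℕ} (hD : 1 ≤ D) :
    ∀ k : ℕ, k * D ≤ Y.card → ∃ 𝓑 : Finset (Finset α), 𝓑.card = k ∧
      (∀ B ∈ 𝓑, B ⊆ Y ∧ B.card = D) ∧ (𝓑 : Set (Finset α)).PairwiseDisjoint id := by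
  intro k
  induction k with
  | zero => intro _; exact ⟨∅, rfl, by simp, by simp⟩
  | succ k ih =>
    intro hk
    obtain ⟨𝓑, hcard, hB, hdisj⟩ := ih (le_trans (Nat.mul_le_mul_right D (Nat.le_succ k)) hk)
    set U : Finset α := 𝓑.biUnion id with hU
    have hUcard : U.card ≤ k * D := by
      calc U.card ≤ ∑ B ∈ 𝓑, (id B).card := card_biUnion_le
        _ = ∑ B ∈ 𝓑, D := sum_congr rfl fun B hB' => (hB B hB').2
        _ = k * D := by rw [sum_const, smul_eq_mul, hcard]
    have hrem : D ≤ (Y \ U).card := by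
      have h1 := le_card_sdiff U Y
      have h2 : (k + 1) * D = k * D + D := by ring
      omega
    obtain ⟨Bnew, hBsub, hBcard⟩ := exists_subset_card_eq hrem
    have hBnewY : Bnew ⊆ Y := hBsub.trans sdiff_subset
    have hBnewU : Disjoint Bnew U := by
      rw [Finset.disjoint_left]
      intro a ha haU
      exact (mem_sdiff.mp (hBsub ha)).2 haU
    have hBdisj : ∀ B ∈ 𝓑, Disjoint Bnew B := by
      intro B hB'
      exact hBnewU.mono_right (subset_biUnion_of_mem id hB')
    have hnotmem : Bnew ∉ 𝓑 := by
      intro hmem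
      have hd := hBdisj Bnew hmem
      rw [disjoint_self, Finset.bot_eq_empty] at hd
      rw [hd, card_empty] at hBcard
      omega
    refine ⟨insert Bnew 𝓑, by rw [card_insert_of_notMem hnotmem, hcard], ?_, ?_⟩
    · intro B hB'
      rcases mem_insert.mp hB' with rfl | hB'
      · exact ⟨hBnewY, hBcard⟩
      · exact hB B hB'
    · rw [coe_insert]
      refine hdisj.insert fun B hB' hne => ?_
      exact hBdisj B (mem_coe.mp hB')

/-! ### The instances: a minimal-weight YES input and its block switch-offs -/

/-- Hamming weight of an indicator input. [cite: ChenEtAl2022, §1.2.2 (GapMAJ: fraction of ones)] -/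
theorem numOnes_indicator (Y : Finset (Fin n)) :
    GateFn.numOnes (fun j : Fin n => decide (j ∈ Y)) = Y.card := by
  unfold GateFn.numOnes
  congr 1
  ext j
  simp

/-- Switching a block `B ⊆ Y` of ones off: `(1_Y)^B = 1_{Y ∖ B}`.
[cite: JuknaBFC2012, §14.3 (the input a^S)] -/
theorem flipBlock_indicator {Y B : Finset (Fin n)} (hB : B ⊆ Y) :
    flipBlock (fun j : Fin n => decide (j ∈ Y)) B = fun j => decide (j ∈ Y \ B) := by
  funext j
  by_cases hj : j ∈ B
  · rw [flipBlock_apply_of_mem hj]; simp [hj, hB hj]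
  · rw [flipBlock_apply_of_not_mem hj]; simp [hj]

/-- **The bound with explicit weights.**  If `A ≤ n` ones make a YES instance, `W` ones a NO
instance, and `k·(A − W) ≤ A`, then every distribution over trees of depth `≤ q` that is
`2/3`-correct on the promise has `k ≤ 3q`.
[cite: Wolf2002, Thm. 16 (Nisan, bs ≤ 3R₂); ChenEtAl2022, §1.2.2 p. 6 L1 (known column, randomized)] -/
theorem le_three_mul_randDepth (μ : PMF (DecisionTree n)) {q e A W k : ℕ}
    (hq : ∀ T ∈ μ.support, T.depth ≤ q)
    (hcorrect : ∀ y ∈ gapMajDomain n e,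
      (2 : ℝ) / 3 ≤ (μ.toOuterMeasure {T | T.eval y = gapMajAnswer e y}).toReal)
    (hAn : A ≤ n) (hyes : e * n + 2 * n < 2 * e * A) (hno : 2 * e * W + 2 * n < e * n)
    (hk : k * (A - W) ≤ A) : k ≤ 3 * q := by
  classical
  have hWA : W < A := by
    by_contra h
    push Not at h
    have : 2 * e * A ≤ 2 * e * W := Nat.mul_le_mul_left _ h
    omega
  have hD : 1 ≤ A - W := by omega
  have hAcard : A ≤ (univ : Finset (Fin n)).card := by rwa [card_univ, Fintype.card_fin]
  obtain ⟨Y, -, hY⟩ := exists_subset_card_eq hAcard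
  obtain ⟨𝓑, hcard, hB, hdisj⟩ := exists_disjoint_blocks Y hD k (by rw [hY]; exact hk)
  rw [← hcard]
  refine card_blocks_le_three_mul μ hq hcorrect (fun j => decide (j ∈ Y)) ?_ 𝓑 hdisj ?_
  · show e * n + 2 * n < 2 * e * GateFn.numOnes (fun j : Fin n => decide (j ∈ Y))
    rw [numOnes_indicator, hY]; exact hyes
  · intro B hB'
    have hflip : flipBlock (fun j : Fin n => decide (j ∈ Y)) B = fun j => decide (j ∈ Y \ B) :=
      flipBlock_indicator (hB B hB').1
    show 2 * e * GateFn.numOnes (flipBlock (fun j : Fin n => decide (j ∈ Y)) B) + 2 * n < e * n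
    rw [hflip, numOnes_indicator, card_sdiff_of_subset (hB B hB').1, hY, (hB B hB').2]
    calc 2 * e * (A - (A - W)) + 2 * n = 2 * e * W + 2 * n := by congr 2; omega
      _ < e * n := hno

/-- **`R_{1/3}(GapMAJ_{n,1/e}) ≥ k/3`** in the tree's `randQueryComplexityOn` (success `≥ 1 − 1/3`
on the promise, depth of the support), for every `k` with `k·(A − W) ≤ A` as above.
[cite: Wolf2002, Thm. 16 (Nisan, bs ≤ 3R₂) with §2.2 (R₂ for partial functions); ChenEtAl2022, p. 6 L1] -/
theorem le_three_mul_randQueryComplexityOn_gapMaj {e A W k : ℕ} (hAn : A ≤ n)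
    (hyes : e * n + 2 * n < 2 * e * A) (hno : 2 * e * W + 2 * n < e * n) (hk : k * (A - W) ≤ A) :
    k ≤ 3 * randQueryComplexityOn (1 / 3) (gapMajDomain n e) (gapMajAnswer (n := n) e) := by
  set S : Set ℕ := {d | ∃ μ : PMF (DecisionTree n), (∀ T ∈ μ.support, T.depth ≤ d) ∧
    ∀ x ∈ gapMajDomain n e,
      1 - (1 : ℝ) / 3 ≤ (μ.toOuterMeasure {T | T.eval x = gapMajAnswer e x}).toReal} with hS
  have hne : S.Nonempty := by
    obtain ⟨T, hT, -⟩ := exists_computes_depth_le (gapMajAnswer (n := n) e)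
    refine ⟨T.depth, PMF.pure T, fun T' hT' => ?_, fun x _ => ?_⟩
    · rw [PMF.support_pure, Set.mem_singleton_iff] at hT'; rw [hT']
    · rw [PMF.toOuterMeasure_pure_apply, if_pos (show T ∈ {T' | T'.eval x = _} from hT x),
        ENNReal.toReal_one]
      norm_num
  obtain ⟨μ, hμq, hμc⟩ := Nat.sInf_mem hne
  have hcorrect : ∀ y ∈ gapMajDomain n e,
      (2 : ℝ) / 3 ≤ (μ.toOuterMeasure {T | T.eval y = gapMajAnswer e y}).toReal := by
    intro y hy; have := hμc y hy; norm_num at this ⊢; exact this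
  exact le_three_mul_randDepth μ hμq hcorrect hAn hyes hno hk

/-! ### The arithmetic of the minimal YES / maximal NO weights -/

/-- With `A = ⌊n/2⌋ + ⌊n/e⌋ + 2` ones the input is a YES instance of `GapMAJ_{n,1/e}` (`e ≥ 1`).
[cite: ChenEtAl2022, §1.2.2 (GapMAJ_{n,ε}: YES iff p > 1/2 + ε)] -/
theorem yes_weight (n e : ℕ) (he : 1 ≤ e) : e * n + 2 * n < 2 * e * (n / 2 + n / e + 2) := by
  have h2 := Nat.div_add_mod n 2
  have he' := Nat.div_add_mod n e
  have hr : n % 2 < 2 := Nat.mod_lt n (by norm_num)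
  have hs : n % e < e := Nat.mod_lt n he
  set a := n / 2
  set b := n / e
  set r := n % 2
  set s := n % e
  have h3 : e * n = 2 * (e * a) + e * r := by rw [← h2]; ring
  have h4 : 2 * n = 2 * (e * b) + 2 * s := by rw [← he']; ring
  have h5 : e * r ≤ e * 1 := Nat.mul_le_mul_left e (by omega)
  nlinarith [h3, h4, h5, hs]

/-- With `W = ⌊n/2⌋ − ⌊n/e⌋ − 2` ones (no truncation) the input is a NO instance (`e ≥ 1`).
[cite: ChenEtAl2022, §1.2.2 (GapMAJ_{n,ε}: NO iff p < 1/2 − ε)] -/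
theorem no_weight (n e W : ℕ) (he : 1 ≤ e) (hW : n / 2 = W + n / e + 2) :
    2 * e * W + 2 * n < e * n := by
  have h2 := Nat.div_add_mod n 2
  have he' := Nat.div_add_mod n e
  have hs : n % e < e := Nat.mod_lt n he
  set a := n / 2
  set b := n / e
  set r := n % 2
  set s := n % e
  have h3 : e * n = 2 * (e * a) + e * r := by rw [← h2]; ring
  have h4 : 2 * n = 2 * (e * b) + 2 * s := by rw [← he']; ring
  have h5 : e * a = e * W + e * b + 2 * e := by rw [hW]; ring
  nlinarith [h3, h4, h5, hs]

/-! ### Row vocabulary: randomized algorithms with few queries fail on some promise input -/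

/-- **Finite form.**  A randomized query algorithm all of whose trees at length `n` have depth
`≤ q(n)` fails on SOME promise input of `GapMAJ_{n,1/e(n)}` whenever
`(3q(n) + 1)·(2⌊n/e(n)⌋ + 4) ≤ ⌊n/2⌋`, `e(n) ≥ 3`, `n ≥ 12` (so `q(n) < e(n)/36`, roughly).
[cite: Wolf2002, Thm. 16 (Nisan, bs ≤ 3R₂); ChenEtAl2022, Def. 1.1 and §1.2.2 p. 6 L1 (known column, Ω(1/ε) part)] -/
theorem exists_failsOn_of_queriesLe (A : RandQueryAlg) {q e : ℕ → ℕ} (hA : A.QueriesLe q) {n : ℕ}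
    (he : 3 ≤ e n) (hn : 12 ≤ n) (h : (3 * q n + 1) * (2 * (n / e n) + 4) ≤ n / 2) :
    ∃ x : Fin n → Bool, A.FailsOn e x := by
  by_contra hnot
  push Not at hnot
  have hcorrect : ∀ y ∈ gapMajDomain n (e n),
      (2 : ℝ) / 3 ≤ ((A n).toOuterMeasure {T | T.eval y = gapMajAnswer (e n) y}).toReal := by
    intro y hy
    have := hnot y
    rw [RandQueryAlg.FailsOn, not_and, not_lt] at this
    exact this hy
  have hbe : n / e n ≤ n / 3 := Nat.div_le_div_left he (by norm_num)
  have hW : n / e n + 2 ≤ n / 2 := by omega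
  obtain ⟨W, hW'⟩ : ∃ W, n / 2 = W + n / e n + 2 := ⟨n / 2 - n / e n - 2, by omega⟩
  have hyes := yes_weight n (e n) (by omega)
  have hno := no_weight n (e n) W (by omega) hW'
  have hAn : n / 2 + n / e n + 2 ≤ n := by omega
  have hk : (3 * q n + 1) * (n / 2 + n / e n + 2 - W) ≤ n / 2 + n / e n + 2 := by
    have : n / 2 + n / e n + 2 - W = 2 * (n / e n) + 4 := by omega
    rw [this]; omega
  have := le_three_mul_randDepth (A n) (hA n) hcorrect hAn hyes hno hk
  omega

/-- **Asymptotic form: `o(1/ε)` queries fail at all large lengths.**  If every tree of `A` at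
length `n` has depth `≤ q(n)` with `q = o(e)`, `e(n) → ∞` and `e(n) ≤ n` eventually (i.e.
`ε ≥ 1/n`), then at all large `n` the algorithm fails on some promise input of `GapMAJ_{n,1/e(n)}`.
The printed known column covers `o(1/ε²)` queries [ChenEtAl2022 p. 6 L1, after CEG95]; this is its
`o(1/ε)` part.  [cite: Wolf2002, Thm. 16 (Nisan, bs ≤ 3R₂); ChenEtAl2022, §1.2.2 p. 6 L1 (known column, Ω(1/ε) part)] -/
theorem eventually_exists_failsOn_of_isLittleO (A : RandQueryAlg) {q e : ℕ → ℕ}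
    (hA : A.QueriesLe q) (hq : (fun n => (q n : ℝ)) =o[atTop] fun n => (e n : ℝ))
    (he : Tendsto e atTop atTop) (hen : ∀ᶠ n in atTop, e n ≤ n) :
    ∀ᶠ n in atTop, ∃ x : Fin n → Bool, A.FailsOn e x := by
  have hq' : ∀ᶠ n in atTop, 100 * q n ≤ e n := by
    have := hq.def (show (0 : ℝ) < 1 / 100 by norm_num)
    filter_upwards [this] with n hn
    rw [Real.norm_natCast, Real.norm_natCast] at hn
    have : (100 * q n : ℝ) ≤ e n := by linarith
    exact_mod_cast this
  have he100 : ∀ᶠ n in atTop, 100 ≤ e n := he.eventually_ge_atTop 100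
  filter_upwards [hq', he100, hen] with n hqn hen' henn
  refine exists_failsOn_of_queriesLe A hA (by omega) (by omega) ?_
  -- `(3q+1)(2⌊n/e⌋+4) ≤ ⌊n/2⌋`, proved after multiplying by `e`
  have hepos : 0 < e n := by omega
  refine Nat.le_of_mul_le_mul_left ?_ hepos
  have hb : e n * (n / e n) ≤ n := Nat.mul_div_le n (e n)
  have ha : n ≤ 2 * (n / 2) + 1 := by omega
  have h1 : e n * ((3 * q n + 1) * (2 * (n / e n) + 4)) ≤ (3 * q n + 1) * (6 * n) := by
    have : e n * (2 * (n / e n) + 4) ≤ 6 * n := by nlinarith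
    calc e n * ((3 * q n + 1) * (2 * (n / e n) + 4))
        = (3 * q n + 1) * (e n * (2 * (n / e n) + 4)) := by ring
      _ ≤ (3 * q n + 1) * (6 * n) := Nat.mul_le_mul_left _ this
  refine h1.trans ?_
  -- `(3q+1)·6n ≤ e·⌊n/2⌋` from `100q ≤ e`, `100 ≤ e`, `n ≥ 100`
  have hn : 100 ≤ n := by omega
  nlinarith [hqn, hen', ha, hn, Nat.zero_le (q n), Nat.zero_le (n / 2)]

/-- The algorithms covered here lie in the row's refuted class: `o(e)` queries are `o(e²)` queries
once `e ≥ 1`.  [cite: ChenEtAl2022, Thm. 1.6 (the class: o(1/ε²) queries)] -/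
theorem mem_subquadraticQueryAlgs_of_isLittleO (A : RandQueryAlg) {q e : ℕ → ℕ} (hG : A.IsGapped)
    (hA : A.QueriesLe q) (hq : (fun n => (q n : ℝ)) =o[atTop] fun n => (e n : ℝ))
    (he : ∀ᶠ n in atTop, 1 ≤ e n) : A ∈ SubquadraticQueryAlgs e := by
  refine ⟨hG, q, hA, hq.trans_isBigO ?_⟩
  refine Asymptotics.IsBigO.of_bound 1 ?_
  filter_upwards [he] with n hn
  rw [Real.norm_natCast, one_mul, Real.norm_of_nonneg (by positivity)]
  have : (1 : ℝ) ≤ e n := by exact_mod_cast hn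
  nlinarith

end Literature.Computability.MetaComplexity.ChenJinSanthanamWilliams2022
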